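import Summits.QuantumFields.YangMills.Theorems.ColdStartUniversalityColdStartSolutionsExistTangentAssembly
import HarnessLib

/-!
# Route `ColdStartUniversality`, support item S (stmt-QuantumFields-24811), line `piwiener`:
# stub B1 — the limit along dyadic levels

Helper file (lead `ym-line-csu-p1`) for stub B1 `stub_tangentSumSq`: letting the dyadic level `n → ∞` in
`level_integral` (dominated convergence for the pathwise terms, `E∫(σ − σₙ)² → 0` for the sampling errors,
`n⁴ N 4⁻ⁿ → 0` for the Gauss terms) gives, for every truncation level `C` and every `θ > 0`,
`E[min 1 |Σ_k Y_k(t)² − Σ_k Y_k(0)²| ; sup |Y| ≤ C] ≤ θ · |κ| t Σ E[sup σ²]` at dyadic `t` (`limit_core`).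

No definition, no sorry.  RECORD-rung plumbing; nothing here bears on the Yang–Mills mass gap. -/

set_option autoImplicit false

noncomputable section

namespace Summit.QuantumFields.YangMills.Theorems.ColdStartUniversality

open MeasureTheory ProbabilityTheory Filter Topology Finset Literature
open scoped NNReal ENNReal BigOperators
open Literature.Probability.Process

variable {Ω : Type} {mΩ : MeasurableSpace Ω} {P : Measure Ω} {d : ℕ} {W : ℝ≥0 → Ω → (Fin d → ℝ)}

/-- The truncation events `{|Y| ≤ C at the dyadic points of [0, t]}` are measurable. [folklore] -/
theorem measurableSet_truncEvent {ι : Type} [Fintype ι] {Y : ι → ℝ≥0 → Ω → ℝ}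
    (hYm : ∀ k (s : ℝ≥0), Measurable fun ω => Y k s ω) (t : ℝ≥0) (C : ℝ) :
    MeasurableSet {ω | ∀ k (m j : ℕ), ((j : ℝ≥0) / 2 ^ m) ≤ t → |Y k ((j : ℝ≥0) / 2 ^ m) ω| ≤ C} := by
  simp only [Set.setOf_forall]
  exact MeasurableSet.iInter fun k => MeasurableSet.iInter fun m => MeasurableSet.iInter fun j =>
    MeasurableSet.iInter fun _ => measurableSet_le (hYm k _).abs measurable_const

/-- **The limit along dyadic levels** (see the file header). [folklore] -/
theorem limit_core [IsProbabilityMeasure P] (hW : IsBrownianVec W P) {ι κ : Type} [Fintype ι]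
    [Fintype κ] [DecidableEq κ] (c : κ → Fin d) (Y b : ι → ℝ≥0 → Ω → ℝ) (σ J' : ι → κ → ℝ≥0 → Ω → ℝ)
    (y₀ : ι → ℝ) (hσa : ∀ k n', Adapted hW.natFiltration (σ k n'))
    (hYp : ∀ k, IsStronglyProgressive hW.natFiltration (Y k))
    (hbp : ∀ k, IsStronglyProgressive hW.natFiltration (b k))
    (hσsup : ∀ k n' (t : ℝ≥0), ∫⁻ ω, ⨆ s ∈ Set.Iic t, ENNReal.ofReal (σ k n' s ω ^ 2) ∂P < ⊤)
    (hfin : ∀ k n' (t : ℝ≥0), sqErr (σ k n') 0 P t ≠ ⊤)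
    (hJ' : ∀ k n', IsItoIntegral (σ k n') (fun t ω => W t ω (c n')) (J' k n') hW.natFiltration P ∧
      Martingale (J' k n') hW.natFiltration P ∧ ∀ t, MemLp (J' k n' t) 2 P)
    (hσp : ∀ k n', IsStronglyProgressive hW.natFiltration (σ k n')) (hc : Function.Injective c)
    (hYc : ∀ᵐ ω ∂P, ∀ k, Continuous fun t => Y k t ω)
    (hbc : ∀ᵐ ω ∂P, ∀ k, Continuous fun t => b k t ω)
    (hσc : ∀ᵐ ω ∂P, ∀ k n', Continuous fun t => σ k n' t ω)
    (hXeq : ∀ᵐ ω ∂P, ∀ (t : ℝ≥0) (k : ι),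
      Y k t ω = y₀ k + (∫ s in (0 : ℝ)..t, b k s.toNNReal ω) + ∑ n', J' k n' t ω)
    (hT1 : ∀ (t : ℝ≥0) (ω : Ω), 2 * ∑ k, Y k t ω * b k t ω + ∑ k, ∑ n', σ k n' t ω ^ 2 = 0)
    (hT2 : ∀ (t : ℝ≥0) (ω : Ω) (n' : κ), ∑ k, Y k t ω * σ k n' t ω = 0)
    (m₀ n₀ C : ℕ) {t : ℝ≥0} (ht : ((m₀ : ℝ≥0) / 2 ^ n₀) = t) {θ : ℝ} (hθ : 0 < θ) :
    ∫ ω, min 1 |(∑ k, Y k t ω ^ 2 - ∑ k, Y k 0 ω ^ 2)| * ({ω | ∀ k (m j : ℕ), ((j : ℝ≥0) / 2 ^ m) ≤ t → |Y k ((j : ℝ≥0) / 2 ^ m) ω| ≤ C}).indicator 1 ω ∂P ≤ θ * (Fintype.card κ * ∑ k : ι, ∑ n' : κ, ((t : ℝ) * (∫⁻ ω, ⨆ s ∈ Set.Iic t, ENNReal.ofReal (σ k n' s ω ^ 2) ∂P).toReal)) := by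
  -- the levels `lv l = n₀ + (m₀ + C + l)` with `Nl l = m₀ 2^(m₀ + C + l)` cells: `Nl l / 2^(lv l) = t`
  set lv : ℕ → ℕ := fun l => n₀ + (m₀ + C + l) with hlv
  set Nl : ℕ → ℕ := fun l => m₀ * 2 ^ (m₀ + C + l) with hNl
  have hlvt : Tendsto lv atTop atTop :=
    tendsto_atTop_atTop.2 fun x => ⟨x, fun l hl => by simp only [hlv]; omega⟩
  have hN : ∀ l, Nl l ≤ lv l * 2 ^ (lv l) := fun l => by
    simp only [hlv, hNl]
    exact Nat.mul_le_mul (by omega) (Nat.pow_le_pow_right two_pos (by omega))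
  have hNt : ∀ l, ((Nl l : ℝ≥0) / 2 ^ (lv l)) = t := fun l => by
    simp only [hlv, hNl, ← ht]
    push_cast
    rw [div_eq_div_iff (pow_ne_zero _ two_ne_zero) (pow_ne_zero _ two_ne_zero)]
    ring
  have hNt' : ∀ l, ((Nl l : ℝ) * (1 / 2 ^ (lv l))) = (t : ℝ) := fun l => by
    have h := congrArg (fun x : ℝ≥0 => (x : ℝ)) (hNt l); push_cast at h; rw [← h]; ring
  have hCn : ∀ l, C ≤ lv l := fun l => by simp only [hlv]; omega
  -- (1) the per-level bound
  have hbound : ∀ l, ∫ ω, min 1 |(∑ k, Y k t ω ^ 2 - ∑ k, Y k 0 ω ^ 2)| * ({ω | ∀ k (m j : ℕ), ((j : ℝ≥0) / 2 ^ m) ≤ t → |Y k ((j : ℝ≥0) / 2 ^ m) ω| ≤ C} ∩ {ω | ∀ k n' (m j : ℕ), ((j : ℝ≥0) / 2 ^ m) ≤ t → |σ k n' ((j : ℝ≥0) / 2 ^ m) ω| ≤ (lv l)}).indicator 1 ω ∂P ≤ (∫ ω, min 1 |(∑ j ∈ range (Nl l), ∑ k, 2 * Y k ((j : ℝ≥0)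 / 2 ^ (lv l)) ω * (∫ s in ((((j : ℝ≥0) / 2 ^ (lv l) : ℝ≥0)) : ℝ)..((((j + 1 : ℕ) : ℝ≥0) / 2 ^ (lv l) : ℝ≥0) : ℝ), b k s.toNNReal ω) + ∑ j ∈ range (Nl l), ∑ k, ∑ n', clamp (lv l) (σ k n' ((j : ℝ≥0) / 2 ^ (lv l)) ω) ^ 2 * (1 / 2 ^ (lv l)))| ∂P) + ∑ k, ∑ n', 2 * Real.sqrt (C ^ 2 * (4 * sqErr (σ k n') (SimpleProcess.sample (σ k n') (hσa k n') (lv l)).toProcess P t).toReal) + (∑ _k : ι, ∑ _n' : κ, Real.sqrt ((gaussFourthMoment - 1) * (((lv l) : ℝ) ^ 2) ^ 2 * ((Nl l) * (1 / 2 ^ (lv l)) ^ 2)) + ∑ _k : ι, ∑ n' : κ, ∑ _n'' ∈ univ.erase n', Real.sqrt ((((lv l) : ℝ) ^ 2) ^ 2 * ((Nl l) * (1 / 2 ^ (lv l)) ^ 2))) + (1 + 1 / θ) * ((∫ ω, min 1 (2 * ∑ j ∈ range (Nl l), ∑ k, (∫ s in ((((j : ℝ≥0) / 2 ^ (lv l)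 : ℝ≥0)) : ℝ)..((((j + 1 : ℕ) : ℝ≥0) / 2 ^ (lv l) : ℝ≥0) : ℝ), b k s.toNNReal ω) ^ 2) ∂P) + 2 * Fintype.card κ * ∑ k, ∑ n', (4 * sqErr (σ k n') (SimpleProcess.sample (σ k n') (hσa k n') (lv l)).toProcess P t).toReal) + θ * (Fintype.card κ * ∑ k : ι, ∑ n', ((Nl l) * ((1 / 2 ^ (lv l)) * (∫⁻ ω, ⨆ s ∈ Set.Iic t, ENNReal.ofReal (σ k n' s ω ^ 2) ∂P).toReal))) := by
    intro l
    have h := level_integral hW c Y b σ J' y₀ hσa hYp hbp hσsup hfin hJ' hσp hc hbc hXeq hT2 (hN l) (hNt l).le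
      (hCn l) hθ
    simp only [hNt l] at h
    exact h
  -- (2) measurability
  have hYm : ∀ k (s : ℝ≥0), Measurable fun ω => Y k s ω := fun k s =>
    ((hYp k).stronglyAdapted s).measurable.mono (hW.natFiltration.le s) le_rfl
  have hσm : ∀ k n' (s : ℝ≥0), Measurable fun ω => σ k n' s ω := fun k n' s =>
    (hσa k n' s).mono (hW.natFiltration.le s) le_rfl
  have hstm : ∀ (n : ℕ) k n' (s : ℝ≥0), Measurable fun ω => clamp n (σ k n' s ω) := fun n k n' s =>
    (continuous_clamp _).measurable.comp (hσm k n' s)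
  have hdAm : ∀ (n : ℕ) k (j : ℕ), Measurable fun ω => (∫ s in ((((j : ℝ≥0) / 2 ^ n : ℝ≥0)) : ℝ)..((((j + 1 : ℕ) : ℝ≥0) / 2 ^ n : ℝ≥0) : ℝ), b k s.toNNReal ω) := fun n k j => by
    have hgrid : ((((j : ℝ≥0) / 2 ^ n : ℝ≥0)) : ℝ) ≤ ((((j + 1 : ℕ) : ℝ≥0) / 2 ^ n : ℝ≥0) : ℝ) := by
      rw [coe_dyadicGrid, coe_dyadicGrid]
      exact div_le_div_of_nonneg_right (by exact_mod_cast Nat.le_succ j) (pow_pos two_pos n).le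
    exact ((stronglyMeasurable_intervalIntegral_of_isStronglyProgressive (hbp k) hgrid
      (le_rfl : ((((j + 1 : ℕ) : ℝ≥0) / 2 ^ n : ℝ≥0) : ℝ) ≤ ((((j + 1 : ℕ) : ℝ≥0) / 2 ^ n : ℝ≥0) : ℝ))).measurable).mono (hW.natFiltration.le _) le_rfl
  have hEC : MeasurableSet {ω | ∀ k (m j : ℕ), ((j : ℝ≥0) / 2 ^ m) ≤ t → |Y k ((j : ℝ≥0) / 2 ^ m) ω| ≤ C} := measurableSet_truncEvent hYm t C
  have hES : ∀ n : ℕ, MeasurableSet {ω | ∀ k n' (m j : ℕ), ((j : ℝ≥0) / 2 ^ m) ≤ t → |σ k n' ((j : ℝ≥0) / 2 ^ m) ω| ≤ n} := fun n => by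
    simp only [Set.setOf_forall]
    exact MeasurableSet.iInter fun k => MeasurableSet.iInter fun n' => MeasurableSet.iInter fun m =>
      MeasurableSet.iInter fun j => MeasurableSet.iInter fun _ => measurableSet_le (hσm k n' _).abs measurable_const
  have hZm : Measurable fun ω => min 1 |(∑ k, Y k t ω ^ 2 - ∑ k, Y k 0 ω ^ 2)| :=
    measurable_const.min ((Finset.measurable_sum _ fun k _ => (hYm k _).pow_const 2).sub
      (Finset.measurable_sum _ fun k _ => (hYm k _).pow_const 2)).abs
  have hmin1 : ∀ x : ℝ, ‖min 1 |x|‖ ≤ 1 := fun x => by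
    rw [Real.norm_eq_abs, abs_of_nonneg (le_min zero_le_one (abs_nonneg _))]; exact min_le_left _ _
  have hmin0 : Continuous fun x : ℝ => min 1 |x| := continuous_const.min continuous_abs
  -- (3) the left-hand side: dominated convergence as the `σ`-truncation event fills up
  have hLHS : Tendsto (fun l => ∫ ω, min 1 |(∑ k, Y k t ω ^ 2 - ∑ k, Y k 0 ω ^ 2)| * ({ω | ∀ k (m j : ℕ), ((j : ℝ≥0) / 2 ^ m) ≤ t → |Y k ((j : ℝ≥0) / 2 ^ m) ω| ≤ C} ∩ {ω | ∀ k n' (m j : ℕ), ((j : ℝ≥0) / 2 ^ m) ≤ t → |σ k n' ((j : ℝ≥0) / 2 ^ m) ω| ≤ (lv l)}).indicator 1 ω ∂P) atTop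
      (𝓝 (∫ ω, min 1 |(∑ k, Y k t ω ^ 2 - ∑ k, Y k 0 ω ^ 2)| * ({ω | ∀ k (m j : ℕ), ((j : ℝ≥0) / 2 ^ m) ≤ t → |Y k ((j : ℝ≥0) / 2 ^ m) ω| ≤ C}).indicator 1 ω ∂P)) := by
    refine tendsto_integral_of_dominated_convergence (fun _ => (1 : ℝ))
      (fun l => (hZm.mul (measurable_one.indicator (hEC.inter (hES _)))).aestronglyMeasurable)
      (integrable_const _) (fun l => ae_of_all _ fun ω => ?_) ?_
    · rw [norm_mul]
      by_cases hω : ω ∈ {ω | ∀ k (m j : ℕ), ((j : ℝ≥0) / 2 ^ m) ≤ t → |Y k ((j : ℝ≥0) / 2 ^ m) ω| ≤ C} ∩ {ω | ∀ k n' (m j : ℕ), ((j : ℝ≥0) / 2 ^ m) ≤ t → |σ k n' ((j : ℝ≥0) / 2 ^ m) ω| ≤ (lv l)}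
      · rw [Set.indicator_of_mem hω, Pi.one_apply, norm_one, mul_one]; exact hmin1 _
      · rw [Set.indicator_of_notMem hω, norm_zero, mul_zero]; exact zero_le_one
    · filter_upwards [hσc] with ω hσω
      obtain ⟨S, -, hS⟩ := exists_bound_le (fun p : ι × κ => fun s => σ p.1 p.2 s ω) (fun p => hσω p.1 p.2) t
      refine tendsto_const_nhds.congr' ?_
      filter_upwards [eventually_ge_atTop ⌈S⌉₊] with l hl
      have hmem : ω ∈ {ω | ∀ k n' (m j : ℕ), ((j : ℝ≥0) / 2 ^ m) ≤ t → |σ k n' ((j : ℝ≥0) / 2 ^ m) ω| ≤ (lv l)} := by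
        intro k n' m j hj
        refine (hS (k, n') _ hj).trans ((Nat.le_ceil S).trans ?_)
        exact_mod_cast hl.trans (by simp only [hlv]; omega)
      by_cases hω : ω ∈ {ω | ∀ k (m j : ℕ), ((j : ℝ≥0) / 2 ^ m) ≤ t → |Y k ((j : ℝ≥0) / 2 ^ m) ω| ≤ C}
      · rw [Set.indicator_of_mem hω, Set.indicator_of_mem (Set.mem_inter hω hmem)]
      · rw [Set.indicator_of_notMem hω, Set.indicator_of_notMem (fun h => hω h.1)]
  -- (4) the right-hand side, term by term
  have p1 : Tendsto (fun l => ∫ ω, min 1 |(∑ j ∈ range (Nl l), ∑ k, 2 * Y k ((j : ℝ≥0) / 2 ^ (lv l)) ω * (∫ s in ((((j : ℝ≥0) / 2 ^ (lv l) : ℝ≥0)) : ℝ)..((((j + 1 : ℕ) : ℝ≥0) / 2 ^ (lv l) : ℝ≥0) : ℝ), b k s.toNNReal ω) + ∑ j ∈ range (Nl l), ∑ k, ∑ n', clamp (lv l) (σ k n' ((j : ℝ≥0) / 2 ^ (lv l)) ω) ^ 2 * (1 / 2 ^ (lv l)))| ∂P) atTop (𝓝 0) := by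
    have hm : ∀ l, Measurable fun ω => (∑ j ∈ range (Nl l), ∑ k, 2 * Y k ((j : ℝ≥0) / 2 ^ (lv l)) ω * (∫ s in ((((j : ℝ≥0) / 2 ^ (lv l) : ℝ≥0)) : ℝ)..((((j + 1 : ℕ) : ℝ≥0) / 2 ^ (lv l) : ℝ≥0) : ℝ), b k s.toNNReal ω) + ∑ j ∈ range (Nl l), ∑ k, ∑ n', clamp (lv l) (σ k n' ((j : ℝ≥0) / 2 ^ (lv l)) ω) ^ 2 * (1 / 2 ^ (lv l))) := fun l =>
      (Finset.measurable_sum _ fun j _ => Finset.measurable_sum _ fun k _ =>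
        (measurable_const.mul (hYm k _)).mul (hdAm _ k j)).add
      (Finset.measurable_sum _ fun j _ => Finset.measurable_sum _ fun k _ => Finset.measurable_sum _ fun n' _ =>
        ((hstm _ k n' _).pow_const 2).mul_const _)
    have h := tendsto_integral_of_dominated_convergence (μ := P) (F := fun l ω => min 1 |(∑ j ∈ range (Nl l), ∑ k, 2 * Y k ((j : ℝ≥0) / 2 ^ (lv l)) ω * (∫ s in ((((j : ℝ≥0) / 2 ^ (lv l) : ℝ≥0)) : ℝ)..((((j + 1 : ℕ) : ℝ≥0) / 2 ^ (lv l) : ℝ≥0) : ℝ), b k s.toNNReal ω) + ∑ j ∈ range (Nl l), ∑ k, ∑ n', clamp (lv l) (σ k n' ((j : ℝ≥0) / 2 ^ (lv l)) ω) ^ 2 * (1 / 2 ^ (lv l)))|)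
      (f := fun _ => 0) (fun _ => (1 : ℝ)) (fun l => (measurable_const.min (hm l).abs).aestronglyMeasurable)
      (integrable_const _) (fun l => ae_of_all _ fun ω => hmin1 _) ?_
    · simpa using h
    filter_upwards [hYc, hbc, hσc] with ω hYω hbω hσω
    have hp := pathTerm_tendsto_zero (fun k s => Y k s ω) (fun k s => b k s ω) (fun k n' s => σ k n' s ω)
      hbω hσω hYω (fun s => hT1 s ω) hlvt hNt
    have h2 := (hmin0.tendsto 0).comp hp
    simp only [Function.comp_def, abs_zero, min_eq_right (zero_le_one : (0 : ℝ) ≤ 1)] at h2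
    exact h2
  have hε : ∀ k n', Tendsto (fun l => (4 * sqErr (σ k n') (SimpleProcess.sample (σ k n') (hσa k n') (lv l)).toProcess P t).toReal) atTop (𝓝 0) := by
    intro k n'
    have h := (sqErr_sample_toReal_tendsto_zero (μ := P) (hσp k n') (hσa k n')
      (hσc.mono fun ω hω => hω k n') (hσsup k n') t).comp hlvt
    have h4 := h.const_mul (4 : ℝ)
    rw [mul_zero] at h4
    refine h4.congr fun l => ?_
    simp [Function.comp, ENNReal.toReal_mul]
  have p2 : Tendsto (fun l => ∑ k, ∑ n', 2 * Real.sqrt (C ^ 2 * (4 * sqErr (σ k n') (SimpleProcess.sample (σ k n') (hσa k n') (lv l)).toProcess P t).toReal)) atTop (𝓝 0) := by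
    have h := tendsto_finsetSum (univ : Finset ι) fun k _ => tendsto_finsetSum (univ : Finset κ) fun n' _ =>
      (((hε k n').const_mul ((C : ℝ) ^ 2)).sqrt).const_mul (2 : ℝ)
    simpa using h
  have hg : Tendsto (fun l => (((lv l : ℕ) : ℝ) ^ 2) ^ 2 * (1 / 2 ^ (lv l))) atTop (𝓝 0) := by
    have h := (tendsto_pow_const_div_const_pow_of_one_lt 4 (one_lt_two (α := ℝ))).comp hlvt
    refine h.congr fun l => ?_
    simp only [Function.comp]
    ring
  have hrate : ∀ A : ℝ, Tendsto (fun l => Real.sqrt (A * (((lv l : ℕ) : ℝ) ^ 2) ^ 2 *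
      ((Nl l : ℝ) * (1 / 2 ^ (lv l)) ^ 2))) atTop (𝓝 0) := by
    intro A
    have heq : ∀ l, A * (((lv l : ℕ) : ℝ) ^ 2) ^ 2 * ((Nl l : ℝ) * (1 / 2 ^ (lv l)) ^ 2) =
        (A * (t : ℝ)) * ((((lv l : ℕ) : ℝ) ^ 2) ^ 2 * (1 / 2 ^ (lv l))) := fun l => by
      rw [← hNt' l]; ring
    simp_rw [heq]
    simpa using (hg.const_mul (A * (t : ℝ))).sqrt
  have p3a : Tendsto (fun l => ∑ _k : ι, ∑ _n' : κ, Real.sqrt ((gaussFourthMoment - 1) * (((lv l) : ℝ) ^ 2) ^ 2 *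
      ((Nl l) * (1 / 2 ^ (lv l)) ^ 2))) atTop (𝓝 0) := by
    have h := tendsto_finsetSum (univ : Finset ι) fun _ _ => tendsto_finsetSum (univ : Finset κ) fun _ _ =>
      hrate (gaussFourthMoment - 1)
    simpa using h
  have p3b : Tendsto (fun l => ∑ _k : ι, ∑ n' : κ, ∑ _n'' ∈ univ.erase n', Real.sqrt ((((lv l) : ℝ) ^ 2) ^ 2 *
      ((Nl l) * (1 / 2 ^ (lv l)) ^ 2))) atTop (𝓝 0) := by
    have h1 : Tendsto (fun l => Real.sqrt ((((lv l) : ℝ) ^ 2) ^ 2 * ((Nl l) * (1 / 2 ^ (lv l)) ^ 2))) atTop (𝓝 0) := by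
      have h := hrate 1; simp_rw [one_mul] at h; exact h
    have h := tendsto_finsetSum (univ : Finset ι) fun _ _ => tendsto_finsetSum (univ : Finset κ) fun n' _ =>
      tendsto_finsetSum (univ.erase n') fun _ _ => h1
    simpa using h
  have p4a : Tendsto (fun l => ∫ ω, min 1 (2 * ∑ j ∈ range (Nl l), ∑ k, (∫ s in ((((j : ℝ≥0) / 2 ^ (lv l) : ℝ≥0)) : ℝ)..((((j + 1 : ℕ) : ℝ≥0) / 2 ^ (lv l) : ℝ≥0) : ℝ), b k s.toNNReal ω) ^ 2) ∂P) atTop (𝓝 0) := by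
    have hm : ∀ l, Measurable fun ω => (2 * ∑ j ∈ range (Nl l), ∑ k, (∫ s in ((((j : ℝ≥0) / 2 ^ (lv l) : ℝ≥0)) : ℝ)..((((j + 1 : ℕ) : ℝ≥0) / 2 ^ (lv l) : ℝ≥0) : ℝ), b k s.toNNReal ω) ^ 2) := fun l =>
      measurable_const.mul (Finset.measurable_sum _ fun j _ => Finset.measurable_sum _ fun k _ =>
        (hdAm _ k j).pow_const 2)
    have hnn : ∀ l ω, 0 ≤ (2 * ∑ j ∈ range (Nl l), ∑ k, (∫ s in ((((j : ℝ≥0) / 2 ^ (lv l) : ℝ≥0)) : ℝ)..((((j + 1 : ℕ) : ℝ≥0) / 2 ^ (lv l) : ℝ≥0) : ℝ), b k s.toNNReal ω) ^ 2) := fun l ω => by positivity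
    have h := tendsto_integral_of_dominated_convergence (μ := P) (F := fun l ω => min 1 (2 * ∑ j ∈ range (Nl l), ∑ k, (∫ s in ((((j : ℝ≥0) / 2 ^ (lv l) : ℝ≥0)) : ℝ)..((((j + 1 : ℕ) : ℝ≥0) / 2 ^ (lv l) : ℝ≥0) : ℝ), b k s.toNNReal ω) ^ 2))
      (f := fun _ => 0) (fun _ => (1 : ℝ)) (fun l => (measurable_const.min (hm l)).aestronglyMeasurable)
      (integrable_const _) (fun l => ae_of_all _ fun ω => by
        rw [Real.norm_eq_abs, abs_of_nonneg (le_min zero_le_one (hnn l ω))]; exact min_le_left _ _) ?_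
    · simpa using h
    filter_upwards [hbc] with ω hbω
    have hq : ∀ k, Tendsto (fun l => ∑ j ∈ range (Nl l), (∫ s in ((((j : ℝ≥0) / 2 ^ (lv l) : ℝ≥0)) : ℝ)..((((j + 1 : ℕ) : ℝ≥0) / 2 ^ (lv l) : ℝ≥0) : ℝ), b k s.toNNReal ω) ^ 2) atTop (𝓝 0) := fun k =>
      quadSum_drift_tendsto_zero (fun s => b k s ω) (hbω k) hlvt hNt
    have hs := (tendsto_finsetSum (univ : Finset ι) fun k _ => hq k).const_mul (2 : ℝ)
    simp only [Finset.sum_const_zero, mul_zero] at hs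
    have hs' : Tendsto (fun l => (2 * ∑ j ∈ range (Nl l), ∑ k, (∫ s in ((((j : ℝ≥0) / 2 ^ (lv l) : ℝ≥0)) : ℝ)..((((j + 1 : ℕ) : ℝ≥0) / 2 ^ (lv l) : ℝ≥0) : ℝ), b k s.toNNReal ω) ^ 2)) atTop (𝓝 0) := by
      refine hs.congr fun l => ?_
      rw [Finset.sum_comm]
    have h2 := (((continuous_const (y := (1 : ℝ))).min continuous_id).tendsto (0 : ℝ)).comp hs'
    simp only [Function.comp_def, id, min_eq_right (zero_le_one : (0 : ℝ) ≤ 1)] at h2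
    exact h2
  have p4b : Tendsto (fun l => 2 * Fintype.card κ * ∑ k, ∑ n', (4 * sqErr (σ k n') (SimpleProcess.sample (σ k n') (hσa k n') (lv l)).toProcess P t).toReal) atTop (𝓝 0) := by
    have h := (tendsto_finsetSum (univ : Finset ι) fun k _ => tendsto_finsetSum (univ : Finset κ) fun n' _ =>
      hε k n').const_mul (2 * Fintype.card κ : ℝ)
    simpa using h
  have p5 : Tendsto (fun l => θ * (Fintype.card κ * ∑ k : ι, ∑ n', ((Nl l) * ((1 / 2 ^ (lv l)) * (∫⁻ ω, ⨆ s ∈ Set.Iic t, ENNReal.ofReal (σ k n' s ω ^ 2) ∂P).toReal))))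
      atTop (𝓝 (θ * (Fintype.card κ * ∑ k : ι, ∑ n' : κ, ((t : ℝ) * (∫⁻ ω, ⨆ s ∈ Set.Iic t, ENNReal.ofReal (σ k n' s ω ^ 2) ∂P).toReal)))) := by
    refine tendsto_const_nhds.congr' (Eventually.of_forall fun l => ?_)
    congr 1; congr 1
    refine Finset.sum_congr rfl fun k _ => Finset.sum_congr rfl fun n' _ => ?_
    rw [← mul_assoc, hNt' l]
  have hRHS := (((p1.add p2).add (p3a.add p3b)).add ((p4a.add p4b).const_mul (1 + 1 / θ))).add p5
  have key := le_of_tendsto_of_tendsto' hLHS hRHS hbound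
  simp only [add_zero, zero_add, mul_zero] at key
  exact key

/-- **Dyadic times**: `Σ_k Y_k(m₀/2^n₀)² = Σ_k Y_k(0)²` almost surely. [folklore] -/
theorem tangentSumSq_dyadic [IsProbabilityMeasure P] (hW : IsBrownianVec W P) {ι κ : Type} [Fintype ι]
    [Fintype κ] [DecidableEq κ] (c : κ → Fin d) (Y b : ι → ℝ≥0 → Ω → ℝ) (σ J' : ι → κ → ℝ≥0 → Ω → ℝ)
    (y₀ : ι → ℝ) (hσa : ∀ k n', Adapted hW.natFiltration (σ k n'))
    (hYp : ∀ k, IsStronglyProgressive hW.natFiltration (Y k))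
    (hbp : ∀ k, IsStronglyProgressive hW.natFiltration (b k))
    (hσsup : ∀ k n' (t : ℝ≥0), ∫⁻ ω, ⨆ s ∈ Set.Iic t, ENNReal.ofReal (σ k n' s ω ^ 2) ∂P < ⊤)
    (hfin : ∀ k n' (t : ℝ≥0), sqErr (σ k n') 0 P t ≠ ⊤)
    (hJ' : ∀ k n', IsItoIntegral (σ k n') (fun t ω => W t ω (c n')) (J' k n') hW.natFiltration P ∧
      Martingale (J' k n') hW.natFiltration P ∧ ∀ t, MemLp (J' k n' t) 2 P)
    (hσp : ∀ k n', IsStronglyProgressive hW.natFiltration (σ k n')) (hc : Function.Injective c)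
    (hYc : ∀ᵐ ω ∂P, ∀ k, Continuous fun t => Y k t ω)
    (hbc : ∀ᵐ ω ∂P, ∀ k, Continuous fun t => b k t ω)
    (hσc : ∀ᵐ ω ∂P, ∀ k n', Continuous fun t => σ k n' t ω)
    (hXeq : ∀ᵐ ω ∂P, ∀ (t : ℝ≥0) (k : ι),
      Y k t ω = y₀ k + (∫ s in (0 : ℝ)..t, b k s.toNNReal ω) + ∑ n', J' k n' t ω)
    (hT1 : ∀ (t : ℝ≥0) (ω : Ω), 2 * ∑ k, Y k t ω * b k t ω + ∑ k, ∑ n', σ k n' t ω ^ 2 = 0)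
    (hT2 : ∀ (t : ℝ≥0) (ω : Ω) (n' : κ), ∑ k, Y k t ω * σ k n' t ω = 0) (m₀ n₀ : ℕ) :
    ∀ᵐ ω ∂P, ∑ k, Y k ((m₀ : ℝ≥0) / 2 ^ n₀) ω ^ 2 = ∑ k, Y k 0 ω ^ 2 := by
  set t : ℝ≥0 := (m₀ : ℝ≥0) / 2 ^ n₀ with ht
  have hYm : ∀ k (s : ℝ≥0), Measurable fun ω => Y k s ω := fun k s =>
    ((hYp k).stronglyAdapted s).measurable.mono (hW.natFiltration.le s) le_rfl
  have hZm : Measurable fun ω => min 1 |(∑ k, Y k t ω ^ 2 - ∑ k, Y k 0 ω ^ 2)| :=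
    measurable_const.min ((Finset.measurable_sum _ fun k _ => (hYm k _).pow_const 2).sub
      (Finset.measurable_sum _ fun k _ => (hYm k _).pow_const 2)).abs
  -- for each truncation level `C`
  have hC : ∀ C : ℕ, ∀ᵐ ω ∂P, ω ∈ {ω | ∀ k (m j : ℕ), ((j : ℝ≥0) / 2 ^ m) ≤ t → |Y k ((j : ℝ≥0) / 2 ^ m) ω| ≤ C} → (∑ k, Y k t ω ^ 2 - ∑ k, Y k 0 ω ^ 2) = 0 := by
    intro C
    have hEC : MeasurableSet {ω | ∀ k (m j : ℕ), ((j : ℝ≥0) / 2 ^ m) ≤ t → |Y k ((j : ℝ≥0) / 2 ^ m) ω| ≤ C} := measurableSet_truncEvent hYm t C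
    have hnn : 0 ≤ fun ω => min 1 |(∑ k, Y k t ω ^ 2 - ∑ k, Y k 0 ω ^ 2)| * ({ω | ∀ k (m j : ℕ), ((j : ℝ≥0) / 2 ^ m) ≤ t → |Y k ((j : ℝ≥0) / 2 ^ m) ω| ≤ C}).indicator 1 ω := fun ω =>
      mul_nonneg (le_min zero_le_one (abs_nonneg _)) (Set.indicator_nonneg (fun _ _ => zero_le_one) _)
    have hI : Integrable (fun ω => min 1 |(∑ k, Y k t ω ^ 2 - ∑ k, Y k 0 ω ^ 2)| * ({ω | ∀ k (m j : ℕ), ((j : ℝ≥0) / 2 ^ m) ≤ t → |Y k ((j : ℝ≥0) / 2 ^ m) ω| ≤ C}).indicator 1 ω) P := by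
      refine (integrable_const (1 : ℝ)).mono' (hZm.mul (measurable_one.indicator hEC)).aestronglyMeasurable
        (ae_of_all _ fun ω => ?_)
      rw [norm_mul, Real.norm_eq_abs, abs_of_nonneg (le_min zero_le_one (abs_nonneg _))]
      by_cases hω : ω ∈ {ω | ∀ k (m j : ℕ), ((j : ℝ≥0) / 2 ^ m) ≤ t → |Y k ((j : ℝ≥0) / 2 ^ m) ω| ≤ C}
      · rw [Set.indicator_of_mem hω, Pi.one_apply, norm_one, mul_one]; exact min_le_left _ _
      · rw [Set.indicator_of_notMem hω, norm_zero, mul_zero]; exact zero_le_one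
    have hle : ∀ θ : ℝ, 0 < θ → ∫ ω, min 1 |(∑ k, Y k t ω ^ 2 - ∑ k, Y k 0 ω ^ 2)| * ({ω | ∀ k (m j : ℕ), ((j : ℝ≥0) / 2 ^ m) ≤ t → |Y k ((j : ℝ≥0) / 2 ^ m) ω| ≤ C}).indicator 1 ω ∂P ≤ θ * (Fintype.card κ * ∑ k : ι, ∑ n' : κ, ((t : ℝ) * (∫⁻ ω, ⨆ s ∈ Set.Iic t, ENNReal.ofReal (σ k n' s ω ^ 2) ∂P).toReal)) :=
      fun θ hθ => limit_core hW c Y b σ J' y₀ hσa hYp hbp hσsup hfin hJ' hσp hc hYc hbc hσc hXeq hT1 hT2 m₀ n₀ C ht.symm hθ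
    have hM0 : 0 ≤ (Fintype.card κ * ∑ k : ι, ∑ n' : κ, ((t : ℝ) * (∫⁻ ω, ⨆ s ∈ Set.Iic t, ENNReal.ofReal (σ k n' s ω ^ 2) ∂P).toReal)) := by positivity
    set L := ∫ ω, min 1 |(∑ k, Y k t ω ^ 2 - ∑ k, Y k 0 ω ^ 2)| * ({ω | ∀ k (m j : ℕ), ((j : ℝ≥0) / 2 ^ m) ≤ t → |Y k ((j : ℝ≥0) / 2 ^ m) ω| ≤ C}).indicator 1 ω ∂P with hL
    have hL0 : L = 0 := by
      refine le_antisymm (le_of_not_gt fun hpos => ?_) (integral_nonneg hnn)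
      have h := hle (L / (2 * ((Fintype.card κ * ∑ k : ι, ∑ n' : κ, ((t : ℝ) * (∫⁻ ω, ⨆ s ∈ Set.Iic t, ENNReal.ofReal (σ k n' s ω ^ 2) ∂P).toReal)) + 1))) (by positivity)
      have h1 : (Fintype.card κ * ∑ k : ι, ∑ n' : κ, ((t : ℝ) * (∫⁻ ω, ⨆ s ∈ Set.Iic t, ENNReal.ofReal (σ k n' s ω ^ 2) ∂P).toReal)) / ((Fintype.card κ * ∑ k : ι, ∑ n' : κ, ((t : ℝ) * (∫⁻ ω, ⨆ s ∈ Set.Iic t, ENNReal.ofReal (σ k n' s ω ^ 2) ∂P).toReal)) + 1) ≤ 1 := (div_le_one (by positivity)).2 (by linarith)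
      have h2 : L / (2 * ((Fintype.card κ * ∑ k : ι, ∑ n' : κ, ((t : ℝ) * (∫⁻ ω, ⨆ s ∈ Set.Iic t, ENNReal.ofReal (σ k n' s ω ^ 2) ∂P).toReal)) + 1)) * (Fintype.card κ * ∑ k : ι, ∑ n' : κ, ((t : ℝ) * (∫⁻ ω, ⨆ s ∈ Set.Iic t, ENNReal.ofReal (σ k n' s ω ^ 2) ∂P).toReal)) = L / 2 * ((Fintype.card κ * ∑ k : ι, ∑ n' : κ, ((t : ℝ) * (∫⁻ ω, ⨆ s ∈ Set.Iic t, ENNReal.ofReal (σ k n' s ω ^ 2) ∂P).toReal)) / ((Fintype.card κ * ∑ k : ι, ∑ n' : κ, ((t : ℝ) * (∫⁻ ω, ⨆ s ∈ Set.Iic t, ENNReal.ofReal (σ k n' s ω ^ 2) ∂P).toReal)) + 1)) := by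
        field_simp
      have h3 : L / 2 * ((Fintype.card κ * ∑ k : ι, ∑ n' : κ, ((t : ℝ) * (∫⁻ ω, ⨆ s ∈ Set.Iic t, ENNReal.ofReal (σ k n' s ω ^ 2) ∂P).toReal)) / ((Fintype.card κ * ∑ k : ι, ∑ n' : κ, ((t : ℝ) * (∫⁻ ω, ⨆ s ∈ Set.Iic t, ENNReal.ofReal (σ k n' s ω ^ 2) ∂P).toReal)) + 1)) ≤ L / 2 * 1 := by gcongr
      linarith
    have hae := (integral_eq_zero_iff_of_nonneg hnn hI).1 hL0
    filter_upwards [hae] with ω hω hmem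
    have hmem' : ω ∈ {ω | ∀ k (m j : ℕ), ((j : ℝ≥0) / 2 ^ m) ≤ t → |Y k ((j : ℝ≥0) / 2 ^ m) ω| ≤ C} := hmem
    rw [Pi.zero_apply, Set.indicator_of_mem hmem', Pi.one_apply, mul_one] at hω
    rcases le_or_gt 1 |(∑ k, Y k t ω ^ 2 - ∑ k, Y k 0 ω ^ 2)| with h1 | h1
    · rw [min_eq_left h1] at hω; exact absurd hω one_ne_zero
    · rw [min_eq_right h1.le] at hω; exact abs_eq_zero.1 hω
  -- almost every path is bounded on `[0, t]`, hence in some truncation event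
  have hex : ∀ᵐ ω ∂P, ∃ C : ℕ, ω ∈ {ω | ∀ k (m j : ℕ), ((j : ℝ≥0) / 2 ^ m) ≤ t → |Y k ((j : ℝ≥0) / 2 ^ m) ω| ≤ C} := by
    filter_upwards [hYc] with ω hYω
    obtain ⟨B, -, hB⟩ := exists_bound_le (fun k s => Y k s ω) hYω t
    exact ⟨⌈B⌉₊, fun k m j hj => (hB k _ hj).trans (Nat.le_ceil B)⟩
  filter_upwards [ae_all_iff.2 hC, hex] with ω h1 h2
  obtain ⟨C, hCω⟩ := h2
  exact sub_eq_zero.1 (h1 C hCω)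

/-- **The dyadic rationals are dense in `ℝ≥0`.** [folklore] -/
theorem denseRange_dyadic : DenseRange (fun q : ℕ × ℕ => ((q.1 : ℝ≥0) / 2 ^ q.2)) := by
  refine Metric.denseRange_iff.2 fun x r hr => ?_
  obtain ⟨n, hn⟩ := exists_pow_lt_of_lt_one hr (by norm_num : (1 / 2 : ℝ) < 1)
  refine ⟨(⌊(x : ℝ) * 2 ^ n⌋₊, n), ?_⟩
  have h2 : (0 : ℝ) < 2 ^ n := pow_pos two_pos n
  have hx : (0 : ℝ) ≤ (x : ℝ) * 2 ^ n := by positivity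
  have hfl := Nat.floor_le hx
  have hlt := Nat.lt_floor_add_one ((x : ℝ) * 2 ^ n)
  rw [NNReal.dist_eq]
  push_cast
  rw [abs_of_nonneg (by rw [sub_nonneg, div_le_iff₀ h2]; exact hfl)]
  calc (x : ℝ) - (⌊(x : ℝ) * 2 ^ n⌋₊ : ℝ) / 2 ^ n < 1 / 2 ^ n := by
        have h3 : (x : ℝ) < ((⌊(x : ℝ) * 2 ^ n⌋₊ : ℝ) + 1) / 2 ^ n := by rw [lt_div_iff₀ h2]; exact hlt
        have e : (((⌊(x : ℝ) * 2 ^ n⌋₊ : ℝ) + 1) / 2 ^ n) = (⌊(x : ℝ) * 2 ^ n⌋₊ : ℝ) / 2 ^ n + 1 / 2 ^ n := by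
          ring
        rw [e] at h3
        linarith
    _ = (1 / 2) ^ n := by rw [one_div_pow]
    _ < r := hn

/-- **Stub B1′ `stub_tangentSumSq`: a tangent Itô system preserves the sum of squares.**  For a Brownian
vector `W`, progressive continuous coefficients with `Y_k = y_k + ∫ b_k ds + Σ_n ∫ σ_kn dW^(c n)` and the
tangency identities `T1 : 2 Σ_k Y_k b_k + Σ_k Σ_n σ_kn² ≡ 0`, `T2 : Σ_k Y_k σ_kn ≡ 0`, almost surely
`Σ_k Y_k(t)² = Σ_k y_k²` for all `t` (direct quadratic-variation argument along dyadic partitions: exact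
second-order telescoping, tangency kills the limits, all error terms vanish; then density of the dyadics and
path continuity).  Revuz–Yor (1999), Ch. IV, (1.8), (2.13), (3.3). [folklore] -/
theorem tangentSumSq :
    ∀ {Ω : Type} [MeasurableSpace Ω] {P : Measure Ω} [IsProbabilityMeasure P] {d : ℕ}
      {W : ℝ≥0 → Ω → (Fin d → ℝ)} (hW : IsBrownianVec W P) {ι κ : Type} [Fintype ι] [Fintype κ]
      (c : κ → Fin d) (_hc : Function.Injective c)
      (Y : ι → ℝ≥0 → Ω → ℝ) (b : ι → ℝ≥0 → Ω → ℝ) (σ : ι → κ → ℝ≥0 → Ω → ℝ)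
      (J : ι → κ → ℝ≥0 → Ω → ℝ) (y₀ : ι → ℝ),
      (∀ k, IsStronglyProgressive hW.natFiltration (Y k)) →
      (∀ k, IsStronglyProgressive hW.natFiltration (b k)) →
      (∀ k n, IsStronglyProgressive hW.natFiltration (σ k n)) →
      (∀ᵐ ω ∂P, ∀ k, Continuous fun t => Y k t ω) →
      (∀ᵐ ω ∂P, ∀ k, Continuous fun t => b k t ω) →
      (∀ᵐ ω ∂P, ∀ k n, Continuous fun t => σ k n t ω) →
      (∀ k n (t : ℝ≥0), sqErr (σ k n) 0 P t ≠ ⊤) →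
      (∀ k n (t : ℝ≥0), ∫⁻ ω, ⨆ s ∈ Set.Iic t, ENNReal.ofReal (σ k n s ω ^ 2) ∂P < ⊤) →
      (∀ k n, IsItoIntegral (σ k n) (fun t ω => W t ω (c n)) (J k n) hW.natFiltration P) →
      (∀ᵐ ω ∂P, ∀ (t : ℝ≥0) (k : ι),
        Y k t ω = y₀ k + (∫ s in (0 : ℝ)..t, b k s.toNNReal ω) + ∑ n, J k n t ω) →
      (∀ (t : ℝ≥0) (ω : Ω), 2 * ∑ k, Y k t ω * b k t ω + ∑ k, ∑ n, σ k n t ω ^ 2 = 0) →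
      (∀ (t : ℝ≥0) (ω : Ω) (n : κ), ∑ k, Y k t ω * σ k n t ω = 0) →
      ∀ᵐ ω ∂P, ∀ t : ℝ≥0, ∑ k, Y k t ω ^ 2 = ∑ k, y₀ k ^ 2 := by
  intro Ω _ P _ d W hW ι κ _ _ c hc Y b σ J y₀ hYp hbp hσp hYc hbc hσc hfin hσsup hJ hXeq hT1 hT2
  classical
  have hσa : ∀ k n, Adapted hW.natFiltration (σ k n) := fun k n => (hσp k n).stronglyAdapted.adapted
  choose J' hJ' using fun k n => exists_isItoIntegral_coord hW (c n) (hσp k n) (hfin k n)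
  have hJJ' : ∀ᵐ ω ∂P, ∀ k n (t : ℝ≥0), J k n t ω = J' k n t ω := by
    have h : ∀ k n, ∀ᵐ ω ∂P, ∀ t : ℝ≥0, J k n t ω = J' k n t ω := fun k n =>
      IsItoIntegral.unique_holds (hJ k n) (hJ' k n).1
    exact eventually_all.2 fun k => eventually_all.2 fun n => h k n
  have hXeq' : ∀ᵐ ω ∂P, ∀ (t : ℝ≥0) (k : ι),
      Y k t ω = y₀ k + (∫ s in (0 : ℝ)..t, b k s.toNNReal ω) + ∑ n, J' k n t ω := by
    filter_upwards [hXeq, hJJ'] with ω h1 h2 t k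
    rw [h1 t k, Finset.sum_congr rfl fun n _ => h2 k n t]
  have hdy : ∀ m₀ n₀ : ℕ, ∀ᵐ ω ∂P, ∑ k, Y k ((m₀ : ℝ≥0) / 2 ^ n₀) ω ^ 2 = ∑ k, Y k 0 ω ^ 2 :=
    fun m₀ n₀ => tangentSumSq_dyadic hW c Y b σ J' y₀ hσa hYp hbp hσsup hfin hJ' hσp hc hYc hbc hσc hXeq'
      hT1 hT2 m₀ n₀
  have hY0 : ∀ᵐ ω ∂P, ∀ k, Y k 0 ω = y₀ k := by
    filter_upwards [hXeq'] with ω h k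
    rw [h 0 k]
    simp [intervalIntegral.integral_same, (hJ' k _).1.apply_zero]
  have hall : ∀ᵐ ω ∂P, ∀ q : ℕ × ℕ, ∑ k, Y k ((q.1 : ℝ≥0) / 2 ^ q.2) ω ^ 2 = ∑ k, Y k 0 ω ^ 2 :=
    ae_all_iff.2 fun q => hdy q.1 q.2
  filter_upwards [hall, hY0, hYc] with ω h h0 hcω t
  have hcont : Continuous fun s : ℝ≥0 => ∑ k, Y k s ω ^ 2 := continuous_finsetSum _ fun k _ => (hcω k).pow 2
  have heq := Continuous.ext_on denseRange_dyadic hcont continuous_const (by rintro _ ⟨q, rfl⟩; exact h q)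
  rw [congrFun heq t]
  exact Finset.sum_congr rfl fun k _ => by rw [h0 k]

end Summit.QuantumFields.YangMills.Theorems.ColdStartUniversality

end
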